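import Summits.QuantumFields.YangMills.Theorems.BalabanUVNodesN15BackgroundMatrixByParts
import Summits.QuantumFields.YangMills.Theorems.BalabanUVNodesN15BackgroundByPartsLayer
import HarnessLib

/-!
# THE BACKGROUND-LIVE OPERATOR LAYER WITH ENTRY 2 BY PARTS — NON-ABELIAN (MATRIX) SPECIES: the carrier, the realised instance and kernel family, and ENTRY 2 UNDER
# THE GUARD FROM THE `U ≡ 1` LETTERS, NO MIXED PIECE (dag-n15-c g8, FILE 13; Track-A node N15 = NE2, s1 «background-layer OPERATOR ingredient»)

`--kind proof --supports stmt-QuantumFields-20544 --as helper` (K3⁷; count-neutral).  Imports BY NAME this seat's FILE 12 `…N15BackgroundMatrixByParts` (`fgradMat`,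
`e0_comp_fgradAdj_eq_e2ByParts_matrix`, `hasMaj_byPartsMult_matrix`, `hasMaj_idef_byPartsMult_matrix`, `hasMaj_mmulOp_translate`, `hasMaj_idef_mmulOp_translate`; through
it FILES 1–6 and this lineage's g2 M1 `…N15BackgroundLayerFirstOrderMatrix`: `coeffBgM₁`, `avgM₁`, `rowLetters_of_reg335M`, `hasMaj_entry01_backgroundM₁`,
`PairSpaceMatrix.unstackM` ∕ `bgPairM` ∕ `hasMaj_unstackM`) and FILE 7a `…N15BackgroundByPartsLayer` (`bpConst2`, `bpConst2_nonneg`, `mKOf_mul`, `mBOf_mul`).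

WHAT.  The matrix twin of FILE 7a.  §1 the carrier `coeffBgMBP J ι π τ τ′ n n′ M θ`: a matrix coefficient family `U = (C′, A′_μ)` is regular iff EVERY ENTRY obeys
FILE 7a's nine scalar clauses (M1's sup ∕ block-oscillation pair, the coarse∕fine gradient letters of the ENTRYWISE quotient `fgradMat`, the translated fit, the
derivative fit, the coarse one-step oscillation); `reg335_coeffBgM₁_of_MBP`.  Pairing ∕ instance (`bgInstanceMBP`, test functions `𝔤 ≅ ℝ^ι`-valued, blocks `liftBlk`).
§2 the four entry operators `bgOpsMBP`: entries 0∕1 from M1's `bgPairM`, ENTRY 2 = the η-defect of the by-parts object `e2OpMBP` (built on `S_ν = G∇_ν*`,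
`∇_ν* = fgradAdj n (liftEquiv e_ν ι)`, `E₀ = pr₀ bgPairM`, multiplier `M_{C − Σ(∇A)∘e⁻¹}`, rows `S_μM_{A_μ∘e⁻¹}`) read on `ι_ν`, entry 3 from `bgDerivedV`; `bgFamilyMBP`.
§3 ★★ `hasMaj_entry2_byParts_matrix`: under M1's guard (`β·(c₃₅|ι|(1+|J|)a₀)·c_r ≤ ½`, `M ≥ 1`, `Mα₀ ≤ a₀`) and the by-parts smallness
`rowConst(|J|, β, c_T, c₃₅|ι|a₀, c_r)·c_r² ≤ ½`, from the `U ≡ 1` letters on the product carrier (pieces, derived pieces, `G∇_ν*`, their η-defects `m₀θ`, the shifts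
`c_T`) and ONE shift-defect row letter: the entry-2 operator at `U` obeys `≤ bpConst2(|J|, β, c_r, m₀, c₃₅|ι|, a₀, c_T, m_T)·θ·e^{−(δ−6σ)d}` — FILE 3 ★★ fed with
M1's entries 0 (`E₀′`, `𝔇E₀`) and FILE 12's matrix letters (row letters = `|ι|`× entry letters: `c₃₅ ↦ c₃₅|ι|`).

HONEST FRAMING.  The by-parts device over Bałaban's (3.52) species IN COORDINATES (`𝔤 ≅ ℝ^ι`, coefficients = free matrix fields; forward orientation; linearised
entrywise transport (C3)); the `U ≡ 1` layer DISPLAYED; nothing about `G(U)` asserted; NE2⁺ NOT PRINTED; N15 not discharged; nothing continuum ∕ OS ∕ mass-gap ∕ Clay.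
-/

noncomputable section

open scoped BigOperators
open Finset

namespace Summit.QuantumFields.YangMills.BalabanUVNodes.N15.BackgroundLayer

open Literature.MathematicalPhysics.QuantumFieldTheory.Balaban1983to89
open Literature.MathematicalPhysics.QuantumFieldTheory.Balaban1983to89.B11SectG (BlockNorm HasMaj RowSum hasMaj_comp hasMaj_comp_exp hasMaj_zero)
open Literature.MathematicalPhysics.QuantumFieldTheory.Balaban1983to89.T4EtaRate (PairedInstance EtaPairing EtaRateIneq342 NE2PlusOperator rateFactor)
open Literature.MathematicalPhysics.QuantumFieldTheory.Balaban1983to89.T4EtaRateDefect (idef idef_apply idef_comp rateWeight)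
open Literature.MathematicalPhysics.QuantumFieldTheory.Balaban1983to89.T4EtaRateCoeffDefect (pull pull_apply diagK diagK_nonneg FibreOsc blockAvg fit_blockAvg)
open Literature.MathematicalPhysics.QuantumFieldTheory.Balaban1983to89.B6RandomWalk (Triangle254)
open Literature.MathematicalPhysics.QuantumFieldTheory.Balaban1983to89.B9SectDSup (inv_one_sub_le_two)
open Summit.QuantumFields.YangMills.BalabanUVNodes.N15.OperatorReadout (opGeo opFamily)
open Summit.QuantumFields.YangMills.BalabanUVNodes.N15.MatrixSpecies (mmulOp mmulOp_apply liftEquiv liftMap liftBlk hasMaj_mmulOp hasMaj_idef_mmulOp)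
open Summit.QuantumFields.YangMills.BalabanUVNodes.N15.SiteLayer (hasMaj_exp_comp_diagK hasMaj_diagK_comp_exp hasMaj_add_exp hasMaj_exp_mono)

variable {d : ℕ}

/-! ## §1 The matrix by-parts carrier, its pairing and instance -/

section Carrier

variable {X X' : Type} (J ι : Type) [Fintype ι] [Fintype X'] [DecidableEq X]

/-- THE NON-ABELIAN FIRST-ORDER CARRIER WITH THE BY-PARTS LETTERS ON EVERY ENTRY: a matrix coefficient family `U = (C′, (A′_μ)_μ)` is `Reg335 c α₀`-regular iff M1's
entrywise sup ∕ block-oscillation pair holds AND every entry of `A′_μ` ∕ its entrywise block average `Ā_μ` obeys FILE 7a's gradient, translated-fit, derivative-fit and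
coarse-oscillation clauses (entrywise quotients `fgradMat` along the lifted translations at reciprocal spacings `n, n′`); `Reg336` repeats it; (3.37)–(3.38) inert.
[cite: Balaban1985BackgroundPropagators, (3.35)–(3.36) p.396 (shapes); (3.52) p.400 (first-order species with `ad`-valued coefficients: shape)] -/
def coeffBgMBP (π : X' → X) (τ : J → X ≃ X) (τ' : J → X' ≃ X') (n n' M θ : ℝ) : B9.Backgrounds where
  Cfg := (X' → Matrix ι ι ℝ) × (J → X' → Matrix ι ι ℝ)
  one := 0
  mul := fun U₁ U₂ => U₁ + U₂
  Reg335 := fun c α₀ U =>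
    (((∀ x' i j, |U.1 x' i j| ≤ c * M * α₀) ∧ ∀ μ x' i j, |U.2 μ x' i j| ≤ c * M * α₀) ∧
      ((∀ i j, FibreOsc π (fun x' => U.1 x' i j) (fun _ => c * M * α₀ * θ)) ∧ ∀ μ i j, FibreOsc π (fun x' => U.2 μ x' i j) (fun _ => c * M * α₀ * θ))) ∧
    ((∀ μ x i j, |fgradMat n (τ μ) ((avgM₁ J ι π U).2 μ) x i j| ≤ c * M * α₀) ∧ (∀ μ x' i j, |fgradMat n' (τ' μ) (U.2 μ) x' i j| ≤ c * M * α₀) ∧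
      (∀ μ x' i j, |U.2 μ ((τ' μ).symm x') i j - (avgM₁ J ι π U).2 μ ((τ μ).symm (π x')) i j| ≤ c * M * α₀ * θ) ∧
      (∀ μ x' i j, |fgradMat n' (τ' μ) (U.2 μ) ((τ' μ).symm x') i j - fgradMat n (τ μ) ((avgM₁ J ι π U).2 μ) ((τ μ).symm (π x')) i j| ≤ c * M * α₀ * θ) ∧
      ∀ μ x i j, |(avgM₁ J ι π U).2 μ x i j - (avgM₁ J ι π U).2 μ ((τ μ).symm x) i j| ≤ c * M * α₀ * θ)
  Reg336 := fun c α₀ U =>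
    (((∀ x' i j, |U.1 x' i j| ≤ c * M * α₀) ∧ ∀ μ x' i j, |U.2 μ x' i j| ≤ c * M * α₀) ∧
      ((∀ i j, FibreOsc π (fun x' => U.1 x' i j) (fun _ => c * M * α₀ * θ)) ∧ ∀ μ i j, FibreOsc π (fun x' => U.2 μ x' i j) (fun _ => c * M * α₀ * θ))) ∧
    ((∀ μ x i j, |fgradMat n (τ μ) ((avgM₁ J ι π U).2 μ) x i j| ≤ c * M * α₀) ∧ (∀ μ x' i j, |fgradMat n' (τ' μ) (U.2 μ) x' i j| ≤ c * M * α₀) ∧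
      (∀ μ x' i j, |U.2 μ ((τ' μ).symm x') i j - (avgM₁ J ι π U).2 μ ((τ μ).symm (π x')) i j| ≤ c * M * α₀ * θ) ∧
      (∀ μ x' i j, |fgradMat n' (τ' μ) (U.2 μ) ((τ' μ).symm x') i j - fgradMat n (τ μ) ((avgM₁ J ι π U).2 μ) ((τ μ).symm (π x')) i j| ≤ c * M * α₀ * θ) ∧
      ∀ μ x i j, |(avgM₁ J ι π U).2 μ x i j - (avgM₁ J ι π U).2 μ ((τ μ).symm x) i j| ≤ c * M * α₀ * θ)
  Cplx337 := fun _ _ _ => True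
  Cplx338 := fun _ _ _ => True

omit [Fintype ι] in
/-- the carrier's (3.35) IMPLIES M1's `coeffBgM₁` letter pair (so M1's entries 0∕1 apply verbatim). [folklore] -/
theorem reg335_coeffBgM₁_of_MBP {π : X' → X} {τ : J → X ≃ X} {τ' : J → X' ≃ X'} {n n' M θ c α₀ : ℝ} {U : (X' → Matrix ι ι ℝ) × (J → X' → Matrix ι ι ℝ)}
    (h : (coeffBgMBP J ι π τ τ' n n' M θ).Reg335 c α₀ U) : (coeffBgM₁ J ι π M θ).Reg335 c α₀ U := h.1

variable {g : B6.Geometry} [Fintype X]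

/-- THE η-PAIRING over the matrix by-parts carriers (NOT PRINTED data), as M1's `bgPairingM₁`: scale shift `m`, identity on sites, pull-back along `liftMap π ι`, entrywise
block-averaged families. [cite: King1986, p.664 (convention before Prop. 3.8)] -/
def bgPairingMBP (blk : X → g.Site) (π : X' → X) (τ : J → X ≃ X) (τ' : J → X' ≃ X') (n n' : ℝ) (m : ℕ) (hL : g.L ≠ 0) (θc θ : ℝ) :
    EtaPairing (opGeo g (X × ι) (liftBlk blk ι)) (fineGeo g (X' × ι) (liftBlk (blk ∘ π) ι) m) (coeffBgMBP J ι (fun x : X => x) τ τ n n g.M θc)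
      (coeffBgMBP J ι π τ τ' n n' g.M θ) where
  n := m
  k_eq := rfl
  L_eq := rfl
  M_eq := rfl
  eta_eq := (bgPairingM₁ J ι blk π m hL θc θ).eta_eq
  ι := fun y => y
  scale_ι := fun _ => rfl
  dist_ι := fun _ _ => rfl
  τ := fun lam => pull (liftMap π ι) lam
  suppIn_τ := fun _ _ h p hp => h (liftMap π ι p) hp
  supNorm_τ := (bgPairingM₁ J ι blk π m hL θc θ).supNorm_τ
  avg := avgM₁ J ι π
  avg_one := avgM₁_zero J ι π

/-- THE REALISED PAIRED INSTANCE of the by-parts non-abelian first-order layer. [cite: Balaban1985BackgroundPropagators, Thm 3.14 pp.426–427 (typing template)] -/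
def bgInstanceMBP (blk : X → g.Site) (π : X' → X) (τ : J → X ≃ X) (τ' : J → X' ≃ X') (n n' : ℝ) (m : ℕ) (hL : g.L ≠ 0) (θc θ : ℝ) : PairedInstance :=
  ⟨opGeo g (X × ι) (liftBlk blk ι), fineGeo g (X' × ι) (liftBlk (blk ∘ π) ι) m, coeffBgMBP J ι (fun x : X => x) τ τ n n g.M θc,
    coeffBgMBP J ι π τ τ' n n' g.M θ, bgPairingMBP J ι blk π τ τ' n n' m hL θc θ⟩

/-- THE GUARD IS LIVE: the fine geometry's size parameter is the datum's `M`. [folklore] -/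
theorem bgInstanceMBP_M (blk : X → g.Site) (π : X' → X) (τ : J → X ≃ X) (τ' : J → X' ≃ X') (n n' : ℝ) (m : ℕ) (hL : g.L ≠ 0) (θc θ : ℝ) :
    (bgInstanceMBP J ι blk π τ τ' n n' m hL θc θ).gf.M = g.M := rfl

end Carrier

/-! ## §2 The four entry operators — entry 2 BY PARTS — and the kernel family -/

section Ops

variable {X X' J ι : Type} [Fintype X] [Fintype X'] [Fintype J] [Fintype ι] [DecidableEq X] [DecidableEq X'] [DecidableEq J] [DecidableEq ι] {g : B6.Geometry}
  (blk : X → g.Site) (π : X' → X)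

/-- THE BY-PARTS DRESSED ENTRY-2 OBJECT of the matrix species at ONE spacing: `E₂ = B̂(1 + K̂)⁻¹` on the tuple carrier with `S_ν = G∇_ν*` (`∇_ν* = fgradAdj n (liftEquiv e_ν ι)`),
`E₀ = pr₀(bgPairM G D C A)`, multiplier `M_{C − Σ_μ(∇_μA_μ)∘e_μ⁻¹}`, rows `S_μM_{A_μ∘e_μ⁻¹}` — which IS `E₀∘∇_ν*` on `ι_ν` (FILE 12 `e0_comp_fgradAdj_eq_e2ByParts_matrix`).
[cite: Balaban1985BackgroundPropagators, (3.42) p.397 (entry «G(U)∇*»: shape) + (3.64)–(3.65) p.402 (mechanism)] -/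
def e2OpMBP (τ : J → X ≃ X) (n : ℝ) (G : (X × ι → ℝ) →ₗ[ℝ] (X × ι → ℝ)) (D : J → (X × ι → ℝ) →ₗ[ℝ] (X × ι → ℝ)) (C : X → Matrix ι ι ℝ)
    (A : J → X → Matrix ι ι ℝ) : ((X × ι) × J → ℝ) →ₗ[ℝ] (X × ι → ℝ) :=
  e2ByParts (bopOf (fun ν => G ∘ₗ fgradAdj n (liftEquiv (τ ν) ι)) (projO none ∘ₗ bgPairM G D C A) (mmulOp (C - ∑ μ, fgradMat n (τ μ) (A μ) ∘ ⇑(τ μ).symm)))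
    (krowOf (fun ν => G ∘ₗ fgradAdj n (liftEquiv (τ ν) ι)) (fun μ => pull (liftEquiv (τ μ) ι)) (fun μ => mmulOp (A μ ∘ ⇑(τ μ).symm)) (fun _ => 0))

/-- THE FOUR ENTRY OPERATORS OF THE BY-PARTS NON-ABELIAN PAIR at a matrix family `U` (coarse partner = entrywise block averages): entries 0∕1 = the `none` ∕ `some ν`
components of M1's `bgPairM`, ENTRY 2 = THE η-DEFECT OF THE BY-PARTS OBJECTS READ ON `ι_ν`, entry 3 = the derived object of `D₃`.
[cite: Balaban1985BackgroundPropagators, (3.42) p.397 (the four entries: shape)] -/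
def bgOpsMBP (τ : J → X ≃ X) (τ' : J → X' ≃ X') (n n' : ℝ) (ν : J) (G D₃ : (X × ι → ℝ) →ₗ[ℝ] (X × ι → ℝ)) (D : J → (X × ι → ℝ) →ₗ[ℝ] (X × ι → ℝ))
    (G' D₃' : (X' × ι → ℝ) →ₗ[ℝ] (X' × ι → ℝ)) (D' : J → (X' × ι → ℝ) →ₗ[ℝ] (X' × ι → ℝ)) :
    Fin 4 → (X' → Matrix ι ι ℝ) × (J → X' → Matrix ι ι ℝ) → ((X × ι → ℝ) →ₗ[ℝ] (X' × ι → ℝ)) :=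
  fun k U => ![idef (pull (liftMap π ι)) (pull (liftMap π ι)) (projO none ∘ₗ bgPairM G' D' U.1 U.2)
      (projO none ∘ₗ bgPairM G D (avgM₁ J ι π U).1 (avgM₁ J ι π U).2),
    idef (pull (liftMap π ι)) (pull (liftMap π ι)) (projO (some ν) ∘ₗ bgPairM G' D' U.1 U.2)
      (projO (some ν) ∘ₗ bgPairM G D (avgM₁ J ι π U).1 (avgM₁ J ι π U).2),
    idef (pull (liftMap (liftMap π ι) J)) (pull (liftMap π ι)) (e2OpMBP τ' n' G' D' U.1 U.2) (e2OpMBP τ n G D (avgM₁ J ι π U).1 (avgM₁ J ι π U).2) ∘ₗ injJ ν,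
    idef (pull (liftMap π ι)) (pull (liftMap π ι)) (bgDerivedV (stack G' D') D₃' (unstackM U.1 U.2))
      (bgDerivedV (stack G D) D₃ (unstackM (avgM₁ J ι π U).1 (avgM₁ J ι π U).2))] k

/-- THE KERNEL FAMILY over the matrix by-parts carrier. [cite: Balaban1985BackgroundPropagators, (3.42) p.397 (shape)] -/
def bgFamilyMBP (τ : J → X ≃ X) (τ' : J → X' ≃ X') (n n' : ℝ) (m : ℕ) (hL : g.L ≠ 0) (θc θ : ℝ) (ν : J) (G D₃ : (X × ι → ℝ) →ₗ[ℝ] (X × ι → ℝ))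
    (D : J → (X × ι → ℝ) →ₗ[ℝ] (X × ι → ℝ)) (G' D₃' : (X' × ι → ℝ) →ₗ[ℝ] (X' × ι → ℝ)) (D' : J → (X' × ι → ℝ) →ₗ[ℝ] (X' × ι → ℝ)) :
    B9.KernelFamily (bgInstanceMBP J ι blk π τ τ' n n' m hL θc θ).gc (bgInstanceMBP J ι blk π τ τ' n n' m hL θc θ).Bf :=
  show B9.KernelFamily (opGeo g (X × ι) (liftBlk blk ι)) (coeffBgMBP J ι π τ τ' n n' g.M θ) from
    opFamily (g := g) (B := coeffBgMBP J ι π τ τ' n n' g.M θ) (liftBlk blk ι) (liftBlk (blk ∘ π) ι) (bgOpsMBP π τ τ' n n' ν G D₃ D G' D₃' D')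

end Ops

/-! ## §3 ENTRY 2 BY PARTS under the guard, matrix species -/

section Entry2

variable {X X' J ι : Type} [Fintype X] [Fintype X'] [Fintype J] [Fintype ι] [DecidableEq X] [DecidableEq X'] [DecidableEq J] [DecidableEq ι] [Nonempty ι]
  {g : B6.Geometry} (blk : X → g.Site) (π : X' → X)

omit [Fintype X] [Fintype J] [DecidableEq X'] [DecidableEq J] [DecidableEq ι] [Nonempty ι] in
/-- row letters of the by-parts clauses: `|ι|`× the entry letters. [folklore] -/
theorem bpRowLetters_of_reg335M {τ : J → X ≃ X} {τ' : J → X' ≃ X'} {n n' M θ c α₀ : ℝ} {U : (X' → Matrix ι ι ℝ) × (J → X' → Matrix ι ι ℝ)}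
    (h : (coeffBgMBP J ι π τ τ' n n' M θ).Reg335 c α₀ U) :
    (∀ μ x i, ∑ j, |fgradMat n (τ μ) ((avgM₁ J ι π U).2 μ) x i j| ≤ c * M * α₀ * Fintype.card ι) ∧
      (∀ μ x' i, ∑ j, |fgradMat n' (τ' μ) (U.2 μ) x' i j| ≤ c * M * α₀ * Fintype.card ι) ∧
      (∀ μ x' i, ∑ j, |U.2 μ ((τ' μ).symm x') i j - (avgM₁ J ι π U).2 μ ((τ μ).symm (π x')) i j| ≤ c * M * α₀ * Fintype.card ι * θ) ∧
      (∀ μ x' i, ∑ j, |fgradMat n' (τ' μ) (U.2 μ) ((τ' μ).symm x') i j - fgradMat n (τ μ) ((avgM₁ J ι π U).2 μ) ((τ μ).symm (π x')) i j| ≤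
        c * M * α₀ * Fintype.card ι * θ) ∧
      ∀ μ x i, ∑ j, |(avgM₁ J ι π U).2 μ x i j - (avgM₁ J ι π U).2 μ ((τ μ).symm x) i j| ≤ c * M * α₀ * Fintype.card ι * θ := by
  obtain ⟨-, hga, hga', hfaT, hfgT, hosc⟩ := h
  have hrow : ∀ {f : ι → ℝ} {b : ℝ}, (∀ j, |f j| ≤ b) → ∑ j, |f j| ≤ b * Fintype.card ι := fun {f b} hf =>
    calc ∑ j, |f j| ≤ ∑ _j : ι, b := Finset.sum_le_sum fun j _ => hf j
      _ = b * Fintype.card ι := by rw [Finset.sum_const, Finset.card_univ, nsmul_eq_mul, mul_comm]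
  have hθ : c * M * α₀ * Fintype.card ι * θ = c * M * α₀ * θ * Fintype.card ι := by ring
  refine ⟨fun μ x i => hrow fun j => hga μ x i j, fun μ x' i => hrow fun j => hga' μ x' i j, fun μ x' i => ?_, fun μ x' i => ?_, fun μ x i => ?_⟩
  · rw [hθ]; exact hrow fun j => hfaT μ x' i j
  · rw [hθ]; exact hrow fun j => hfgT μ x' i j
  · rw [hθ]; exact hrow fun j => hosc μ x i j

variable {τ : J → X ≃ X} {τ' : J → X' ≃ X'} {n n' : ℝ} {G : (X × ι → ℝ) →ₗ[ℝ] (X × ι → ℝ)} {D : J → (X × ι → ℝ) →ₗ[ℝ] (X × ι → ℝ)}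
  {G' : (X' × ι → ℝ) →ₗ[ℝ] (X' × ι → ℝ)} {D' : J → (X' × ι → ℝ) →ₗ[ℝ] (X' × ι → ℝ)}
set_option maxHeartbeats 400000 in
/-- ★★ **ENTRY 2 OF THE NON-ABELIAN FIRST-ORDER PAIR, BY PARTS, UNDER THE GUARD** — NO MIXED PIECE.  Data: a [B6] carrier ((2.54), `d ≥ 0`, `d(y,y) = 0`, (2.61) at `σ ≥ 0`,
`6σ ≤ δ`); lattices `X, X′` paired by `π`, colour components `ι` (nonempty), translations `τ, τ′` at reciprocal spacings `n, n′` lifted to the product carriers; the `U ≡ 1`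
LAYER on the product carriers at rate `δ`: pieces `G, G′`, derived pieces `D_μ, D′_μ` `≤ βe^{−δd}` with defects `m₀θe^{−δd}`, the `U ≡ 1` ENTRY-2 operators `G∇_ν*, G′∇′_ν*`
`≤ βe^{−δd}` with defects `≤ m₀θe^{−δd}`, the shifts `≤ c_Te^{−δd}`; a `Reg335`-regular matrix family `U` of `coeffBgMBP` under M1's guard (`c₃₅ > 0`,
`β(c₃₅|ι|(1+|J|)a₀)c_r ≤ ½`, `M ≥ 1`, `Mα₀ ≤ a₀`) and the by-parts smallness `rowConst(|J|, β, c_T, c₃₅|ι|a₀, c_r)·c_r² ≤ ½`; and THE SHIFT-DEFECT ROW LETTER at `U`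
(`≤ m_Tθe^{−δd}`).  CONCLUSION: the entry-2 operator of `bgOpsMBP` at `U` obeys `≤ bpConst2(|J|, β, c_r, m₀, c₃₅|ι|, a₀, c_T, m_T)·θ·e^{−(δ−6σ)d}`.  Assembled from FILE 3 ★★
with `E₀′` = B1a's Neumann bound over `hasMaj_unstackM`, `𝔇(E₀′,E₀)` = M1 `hasMaj_entry01_backgroundM₁`, multiplier ∕ coefficient letters = FILE 12 on the row letters.
[cite: Balaban1985BackgroundPropagators, Thm 3.1 (3.42) p.397 (entry «G(U)∇*»: shape) + (3.52) p.400 + (3.64)–(3.65) p.402 (mechanism)] -/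
theorem hasMaj_entry2_byParts_matrix (htri : Triangle254 g) (hd : ∀ a b : g.Site, 0 ≤ g.dist a b) (hd0 : ∀ y : g.Site, g.dist y y = 0) {σ cr : ℝ} (hσ : 0 ≤ σ)
    (hcr : 0 ≤ cr) (hrow : RowSum g σ cr) {δ β m₀ θ c35 a₀ M α₀ cT mT : ℝ} (hσδ : 6 * σ ≤ δ) (hβ : 0 ≤ β) (hm₀ : 0 ≤ m₀) (hθ : 0 ≤ θ) (hc35 : 0 < c35)
    (ha₀ : 0 ≤ a₀) (hq : β * (c35 * (Fintype.card ι * (1 + Fintype.card J)) * a₀) * cr ≤ 1 / 2) (hM : 1 ≤ M) (hα₀ : 0 < α₀) (hMα : M * α₀ ≤ a₀)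
    (hcT : 0 ≤ cT) (hmT : 0 ≤ mT) (hq2 : 1 * rowConst (Fintype.card J) β cT (c35 * Fintype.card ι * a₀) cr * cr * cr ≤ 1 / 2)
    (hG : HasMaj (BlockNorm.ofBlocks g (liftBlk blk ι)) (BlockNorm.ofBlocks g (liftBlk blk ι)) G (fun y y' => β * Real.exp (-(δ * g.dist y y'))))
    (hD : ∀ μ, HasMaj (BlockNorm.ofBlocks g (liftBlk blk ι)) (BlockNorm.ofBlocks g (liftBlk blk ι)) (D μ) (fun y y' => β * Real.exp (-(δ * g.dist y y'))))
    (hG' : HasMaj (BlockNorm.ofBlocks g (liftBlk (blk ∘ π) ι)) (BlockNorm.ofBlocks g (liftBlk (blk ∘ π) ι)) G' (fun y y' => β * Real.exp (-(δ * g.dist y y'))))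
    (hD' : ∀ μ, HasMaj (BlockNorm.ofBlocks g (liftBlk (blk ∘ π) ι)) (BlockNorm.ofBlocks g (liftBlk (blk ∘ π) ι)) (D' μ)
      (fun y y' => β * Real.exp (-(δ * g.dist y y'))))
    (hDG : HasMaj (BlockNorm.ofBlocks g (liftBlk blk ι)) (BlockNorm.ofBlocks g (liftBlk (blk ∘ π) ι)) (idef (pull (liftMap π ι)) (pull (liftMap π ι)) G' G)
      (fun y y' => m₀ * θ * Real.exp (-(δ * g.dist y y'))))
    (hDD : ∀ μ, HasMaj (BlockNorm.ofBlocks g (liftBlk blk ι)) (BlockNorm.ofBlocks g (liftBlk (blk ∘ π) ι))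
      (idef (pull (liftMap π ι)) (pull (liftMap π ι)) (D' μ) (D μ)) (fun y y' => m₀ * θ * Real.exp (-(δ * g.dist y y'))))
    (hS : ∀ ν, HasMaj (BlockNorm.ofBlocks g (liftBlk blk ι)) (BlockNorm.ofBlocks g (liftBlk blk ι)) (G ∘ₗ fgradAdj n (liftEquiv (τ ν) ι))
      (fun y y' => β * Real.exp (-(δ * g.dist y y'))))
    (hS' : ∀ ν, HasMaj (BlockNorm.ofBlocks g (liftBlk (blk ∘ π) ι)) (BlockNorm.ofBlocks g (liftBlk (blk ∘ π) ι)) (G' ∘ₗ fgradAdj n' (liftEquiv (τ' ν) ι))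
      (fun y y' => β * Real.exp (-(δ * g.dist y y'))))
    (hDS : ∀ ν, HasMaj (BlockNorm.ofBlocks g (liftBlk blk ι)) (BlockNorm.ofBlocks g (liftBlk (blk ∘ π) ι))
      (idef (pull (liftMap π ι)) (pull (liftMap π ι)) (G' ∘ₗ fgradAdj n' (liftEquiv (τ' ν) ι)) (G ∘ₗ fgradAdj n (liftEquiv (τ ν) ι)))
      (fun y y' => m₀ * θ * Real.exp (-(δ * g.dist y y'))))
    (hSh : ∀ μ, HasMaj (BlockNorm.ofBlocks g (liftBlk blk ι)) (BlockNorm.ofBlocks g (liftBlk blk ι)) (pull (liftEquiv (τ μ) ι))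
      (fun y y' => cT * Real.exp (-(δ * g.dist y y'))))
    (hSh' : ∀ μ, HasMaj (BlockNorm.ofBlocks g (liftBlk (blk ∘ π) ι)) (BlockNorm.ofBlocks g (liftBlk (blk ∘ π) ι)) (pull (liftEquiv (τ' μ) ι))
      (fun y y' => cT * Real.exp (-(δ * g.dist y y'))))
    {U : (X' → Matrix ι ι ℝ) × (J → X' → Matrix ι ι ℝ)} (hreg : (coeffBgMBP J ι π τ τ' n n' M θ).Reg335 c35 α₀ U)
    (hDSh : ∀ μ, HasMaj (BlockNorm.ofBlocks g (liftBlk (liftBlk blk ι) J)) (BlockNorm.ofBlocks g (liftBlk (blk ∘ π) ι))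
      (idef (pull (liftMap π ι)) (pull (liftMap π ι)) (pull (liftEquiv (τ' μ) ι)) (pull (liftEquiv (τ μ) ι)) ∘ₗ
        (mmulOp ((avgM₁ J ι π U).2 μ ∘ ⇑(τ μ).symm) ∘ₗ sumJ fun ν => G ∘ₗ fgradAdj n (liftEquiv (τ ν) ι)))
      (fun y y' => mT * θ * Real.exp (-(δ * g.dist y y'))))
    (ν : J) :
    HasMaj (BlockNorm.ofBlocks g (liftBlk blk ι)) (BlockNorm.ofBlocks g (liftBlk (blk ∘ π) ι))
      (idef (pull (liftMap (liftMap π ι) J)) (pull (liftMap π ι)) (e2OpMBP τ' n' G' D' U.1 U.2) (e2OpMBP τ n G D (avgM₁ J ι π U).1 (avgM₁ J ι π U).2) ∘ₗ injJ ν)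
      (fun y y' => bpConst2 (Fintype.card J) β cr m₀ (c35 * Fintype.card ι) a₀ cT mT * θ * Real.exp (-((δ - 6 * σ) * g.dist y y'))) := by
  have hreg₁ : (coeffBgM₁ J ι π M θ).Reg335 c35 α₀ U := reg335_coeffBgM₁_of_MBP J ι hreg
  -- row letters
  set r : ℝ := c35 * M * α₀ with hr_def
  have hι1 : (1 : ℝ) ≤ Fintype.card ι := by exact_mod_cast Fintype.card_pos
  have hι0 : (0 : ℝ) ≤ Fintype.card ι := zero_le_one.trans hι1
  have hnJ : (0 : ℝ) ≤ Fintype.card J := Nat.cast_nonneg _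
  have hJ0 : (0 : ℝ) ≤ 1 + Fintype.card J := by positivity
  have hM0 : 0 ≤ M := zero_le_one.trans hM
  have hr0 : 0 ≤ r := by positivity
  obtain ⟨hc, ha, hc', ha', hfc, hfa⟩ := rowLetters_of_reg335M (J := J) (ι := ι) π hr0 hreg₁
  obtain ⟨hga, hga', hfaT, hfgT, hosc⟩ := bpRowLetters_of_reg335M π hreg
  set r' : ℝ := r * Fintype.card ι with hr'_def
  have hr'0 : 0 ≤ r' := mul_nonneg hr0 hι0
  have hca0 : 0 ≤ c35 * Fintype.card ι * a₀ := by positivity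
  have hra : r' ≤ c35 * Fintype.card ι * a₀ := by
    rw [hr'_def, hr_def]
    calc c35 * M * α₀ * Fintype.card ι = c35 * Fintype.card ι * (M * α₀) := by ring
      _ ≤ c35 * Fintype.card ι * a₀ := mul_le_mul_of_nonneg_left hMα (by positivity)
  have hσδ' : σ ≤ δ := by linarith
  -- (E₀′): the fine dressed propagator's majorant `≤ 2β·e^{−(δ−σ)d}`
  have hRa : r' * (1 + Fintype.card J) ≤ c35 * (Fintype.card ι * (1 + Fintype.card J)) * a₀ := by
    calc r' * (1 + Fintype.card J) ≤ c35 * Fintype.card ι * a₀ * (1 + Fintype.card J) := mul_le_mul_of_nonneg_right hra hJ0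
      _ = c35 * (Fintype.card ι * (1 + Fintype.card J)) * a₀ := by ring
  have hR0 : 0 ≤ r' * (1 + Fintype.card J) := mul_nonneg hr'0 hJ0
  have hq' : β * (r' * (1 + Fintype.card J)) * cr ≤ 1 / 2 := (mul_le_mul_of_nonneg_right (mul_le_mul_of_nonneg_left hRa hβ) hcr).trans hq
  have hq1 : β * (r' * (1 + Fintype.card J)) * cr < 1 := by linarith
  have hinv : (1 - β * (r' * (1 + Fintype.card J)) * cr)⁻¹ ≤ 2 := inv_one_sub_le_two hq'
  have hV' : HasMaj (BlockNorm.ofBlocks g (blkPair (liftBlk (blk ∘ π) ι))) (BlockNorm.ofBlocks g (liftBlk (blk ∘ π) ι)) (unstackM U.1 U.2)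
      (diagK fun _ => r' * (1 + Fintype.card J)) := hasMaj_unstackM (blk ∘ π) hr'0 hc' ha'
  have hSG' := hasMaj_stack (liftBlk (blk ∘ π) ι) (fun _ _ => mul_nonneg hβ (Real.exp_nonneg _)) hG' hD'
  have hX' := hasMaj_bgPropV (liftBlk (blk ∘ π) ι) (blkPair (liftBlk (blk ∘ π) ι)) htri hd hrow hσ (ρ := δ - σ) (by linarith) (by linarith) hβ hR0 hSG' hV' hq1
  have hE' : HasMaj (BlockNorm.ofBlocks g (liftBlk (blk ∘ π) ι)) (BlockNorm.ofBlocks g (liftBlk (blk ∘ π) ι)) (projO none ∘ₗ bgPairM G' D' U.1 U.2)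
      (fun y y' => β * 2 * Real.exp (-((δ - σ) * g.dist y y'))) :=
    (hasMaj_projO_comp (liftBlk (blk ∘ π) ι) hX' none).mono fun y y' =>
      mul_le_mul_of_nonneg_right (mul_le_mul_of_nonneg_left hinv hβ) (Real.exp_nonneg _)
  -- (𝔇E₀): M1's entry 0
  have hDE := hasMaj_entry01_backgroundM₁ blk π htri hd hσ hcr hrow hσδ' hβ hm₀ hθ hc35 hq hM hα₀ hMα hG hD hG' hD' hDG hDD hreg₁ none
  -- multiplier letters (FILE 12), weakened to the guard
  have hdiag : ∀ {t t' : ℝ}, t ≤ t' → ∀ y y' : g.Site, diagK (fun _ => t) y y' ≤ diagK (fun _ => t') y y' :=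
    fun h y y' => T4EtaRateCoeffDefect.diagK_mono (fun _ => h) y y'
  have hrR : r' + Fintype.card J * r' ≤ c35 * Fintype.card ι * a₀ * (1 + Fintype.card J) := by nlinarith
  have hR : HasMaj (BlockNorm.ofBlocks g (liftBlk blk ι)) (BlockNorm.ofBlocks g (liftBlk blk ι))
      (mmulOp ((avgM₁ J ι π U).1 - ∑ μ, fgradMat n (τ μ) ((avgM₁ J ι π U).2 μ) ∘ ⇑(τ μ).symm))
      (diagK fun _ => c35 * Fintype.card ι * a₀ * (1 + Fintype.card J)) :=
    (hasMaj_byPartsMult_matrix blk hr'0 hr'0 hc hga).mono (hdiag hrR)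
  have hR' : HasMaj (BlockNorm.ofBlocks g (liftBlk (blk ∘ π) ι)) (BlockNorm.ofBlocks g (liftBlk (blk ∘ π) ι))
      (mmulOp (U.1 - ∑ μ, fgradMat n' (τ' μ) (U.2 μ) ∘ ⇑(τ' μ).symm)) (diagK fun _ => c35 * Fintype.card ι * a₀ * (1 + Fintype.card J)) :=
    (hasMaj_byPartsMult_matrix (blk ∘ π) hr'0 hr'0 hc' hga').mono (hdiag hrR)
  have hraθ : r' * θ ≤ c35 * Fintype.card ι * a₀ * θ := mul_le_mul_of_nonneg_right hra hθ
  have hoR : r' * θ + Fintype.card J * (r' * θ) ≤ c35 * Fintype.card ι * a₀ * (1 + Fintype.card J) * θ := by nlinarith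
  have hDR : HasMaj (BlockNorm.ofBlocks g (liftBlk blk ι)) (BlockNorm.ofBlocks g (liftBlk (blk ∘ π) ι))
      (idef (pull (liftMap π ι)) (pull (liftMap π ι)) (mmulOp (U.1 - ∑ μ, fgradMat n' (τ' μ) (U.2 μ) ∘ ⇑(τ' μ).symm))
        (mmulOp ((avgM₁ J ι π U).1 - ∑ μ, fgradMat n (τ μ) ((avgM₁ J ι π U).2 μ) ∘ ⇑(τ μ).symm)))
      (diagK fun _ => c35 * Fintype.card ι * a₀ * (1 + Fintype.card J) * θ) :=
    (hasMaj_idef_byPartsMult_matrix blk π (mul_nonneg hr'0 hθ) hfc hfgT).mono (hdiag hoR)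
  -- coefficient letters
  have hCa : ∀ μ, HasMaj (BlockNorm.ofBlocks g (liftBlk blk ι)) (BlockNorm.ofBlocks g (liftBlk blk ι)) (mmulOp ((avgM₁ J ι π U).2 μ ∘ ⇑(τ μ).symm))
      (diagK fun _ => c35 * Fintype.card ι * a₀) := fun μ => (hasMaj_mmulOp_translate blk hr'0 ha μ).mono (hdiag hra)
  have hCa' : ∀ μ, HasMaj (BlockNorm.ofBlocks g (liftBlk (blk ∘ π) ι)) (BlockNorm.ofBlocks g (liftBlk (blk ∘ π) ι)) (mmulOp (U.2 μ ∘ ⇑(τ' μ).symm))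
      (diagK fun _ => c35 * Fintype.card ι * a₀) := fun μ => (hasMaj_mmulOp_translate (blk ∘ π) hr'0 ha' μ).mono (hdiag hra)
  have hoa0 : r' * θ ≤ c35 * Fintype.card ι * a₀ * (1 + Fintype.card J) * θ := by nlinarith [mul_nonneg (mul_nonneg hca0 hnJ) hθ]
  have hDCa : ∀ μ, HasMaj (BlockNorm.ofBlocks g (liftBlk blk ι)) (BlockNorm.ofBlocks g (liftBlk (blk ∘ π) ι))
      (idef (pull (liftMap π ι)) (pull (liftMap π ι)) (mmulOp (U.2 μ ∘ ⇑(τ' μ).symm)) (mmulOp ((avgM₁ J ι π U).2 μ ∘ ⇑(τ μ).symm)))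
      (diagK fun _ => c35 * Fintype.card ι * a₀ * (1 + Fintype.card J) * θ) :=
    fun μ => (hasMaj_idef_mmulOp_translate blk π μ (mul_nonneg hr'0 hθ) (hfaT μ)).mono (hdiag hoa0)
  have hCb : ∀ _μ : J, HasMaj (BlockNorm.ofBlocks g (liftBlk blk ι)) (BlockNorm.ofBlocks g (liftBlk blk ι)) (0 : (X × ι → ℝ) →ₗ[ℝ] (X × ι → ℝ))
      (diagK fun _ => c35 * Fintype.card ι * a₀) := fun _ => hasMaj_zero_diagK (liftBlk blk ι) (liftBlk blk ι) hca0
  have hCb' : ∀ _μ : J, HasMaj (BlockNorm.ofBlocks g (liftBlk (blk ∘ π) ι)) (BlockNorm.ofBlocks g (liftBlk (blk ∘ π) ι))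
      (0 : (X' × ι → ℝ) →ₗ[ℝ] (X' × ι → ℝ)) (diagK fun _ => c35 * Fintype.card ι * a₀) :=
    fun _ => hasMaj_zero_diagK (liftBlk (blk ∘ π) ι) (liftBlk (blk ∘ π) ι) hca0
  have hDCb : ∀ _μ : J, HasMaj (BlockNorm.ofBlocks g (liftBlk blk ι)) (BlockNorm.ofBlocks g (liftBlk (blk ∘ π) ι))
      (idef (pull (liftMap π ι)) (pull (liftMap π ι)) (0 : (X' × ι → ℝ) →ₗ[ℝ] (X' × ι → ℝ)) (0 : (X × ι → ℝ) →ₗ[ℝ] (X × ι → ℝ)))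
      (diagK fun _ => c35 * Fintype.card ι * a₀ * (1 + Fintype.card J) * θ) :=
    fun _ => hasMaj_idef_zero_diagK (liftBlk blk ι) (liftMap π ι) (by positivity)
  -- rate-lowered `U ≡ 1` letters at `δ − σ`
  have hS1 : ∀ ν, HasMaj (BlockNorm.ofBlocks g (liftBlk blk ι)) (BlockNorm.ofBlocks g (liftBlk blk ι)) (G ∘ₗ fgradAdj n (liftEquiv (τ ν) ι))
      (fun y y' => β * Real.exp (-((δ - σ) * g.dist y y'))) := fun ν => hasMaj_exp_mono hd hβ (by linarith) (hS ν)
  have hS1' : ∀ ν, HasMaj (BlockNorm.ofBlocks g (liftBlk (blk ∘ π) ι)) (BlockNorm.ofBlocks g (liftBlk (blk ∘ π) ι)) (G' ∘ₗ fgradAdj n' (liftEquiv (τ' ν) ι))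
      (fun y y' => β * Real.exp (-((δ - σ) * g.dist y y'))) := fun ν => hasMaj_exp_mono hd hβ (by linarith) (hS' ν)
  have hDS1 : ∀ ν, HasMaj (BlockNorm.ofBlocks g (liftBlk blk ι)) (BlockNorm.ofBlocks g (liftBlk (blk ∘ π) ι))
      (idef (pull (liftMap π ι)) (pull (liftMap π ι)) (G' ∘ₗ fgradAdj n' (liftEquiv (τ' ν) ι)) (G ∘ₗ fgradAdj n (liftEquiv (τ ν) ι)))
      (fun y y' => m₀ * θ * Real.exp (-((δ - σ) * g.dist y y'))) := fun ν => hasMaj_exp_mono hd (mul_nonneg hm₀ hθ) (by linarith) (hDS ν)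
  have hSh1 : ∀ μ, HasMaj (BlockNorm.ofBlocks g (liftBlk blk ι)) (BlockNorm.ofBlocks g (liftBlk blk ι)) (pull (liftEquiv (τ μ) ι))
      (fun y y' => cT * Real.exp (-((δ - σ) * g.dist y y'))) := fun μ => hasMaj_exp_mono hd hcT (by linarith) (hSh μ)
  have hSh1' : ∀ μ, HasMaj (BlockNorm.ofBlocks g (liftBlk (blk ∘ π) ι)) (BlockNorm.ofBlocks g (liftBlk (blk ∘ π) ι)) (pull (liftEquiv (τ' μ) ι))
      (fun y y' => cT * Real.exp (-((δ - σ) * g.dist y y'))) := fun μ => hasMaj_exp_mono hd hcT (by linarith) (hSh' μ)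
  have hDSh1 : ∀ μ, HasMaj (BlockNorm.ofBlocks g (liftBlk (liftBlk blk ι) J)) (BlockNorm.ofBlocks g (liftBlk (blk ∘ π) ι))
      (idef (pull (liftMap π ι)) (pull (liftMap π ι)) (pull (liftEquiv (τ' μ) ι)) (pull (liftEquiv (τ μ) ι)) ∘ₗ
        (mmulOp ((avgM₁ J ι π U).2 μ ∘ ⇑(τ μ).symm) ∘ₗ sumJ fun ν => G ∘ₗ fgradAdj n (liftEquiv (τ ν) ι)))
      (fun y y' => mT * θ * Real.exp (-((δ - σ) * g.dist y y'))) := fun μ => hasMaj_exp_mono hd (mul_nonneg hmT hθ) (by linarith) (hDSh μ)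
  have hq2' : 1 * rowConst (Fintype.card J) β cT (c35 * Fintype.card ι * a₀) cr * cr * cr < 1 := by linarith
  -- FILE 3 ★★ at rate `δ − σ`, final rate `δ − 6σ`
  have hC0 : 0 ≤ bgConst β cr m₀ (c35 * (Fintype.card ι * (1 + Fintype.card J))) a₀ := bgConst_nonneg hβ hcr hm₀ (by positivity) ha₀
  have key := hasMaj_idef_entry2_of_letters (liftBlk blk ι) (liftMap π ι) htri hd hd0 hrow hσ hcr (δ := δ - σ) (ρ := δ - 6 * σ) (by linarith) (by linarith) hβ
    (by positivity) (by positivity) hcT hca0 (mul_nonneg hm₀ hθ) (mul_nonneg hC0 hθ) (by positivity) (mul_nonneg hmT hθ)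
    hS1 hS1' hE' hR hR' hSh1 hSh1' hCa hCa' hCb hCb' hDS1 hDE hDR hDCa hDCb hDSh1 hq2'
  have hA : 0 ≤ (1 * (1 - 1 * rowConst (Fintype.card J) β cT (c35 * Fintype.card ι * a₀) cr * cr * cr))⁻¹ := by
    rw [one_mul]; exact inv_nonneg.2 (by linarith)
  refine ((hasMaj_exp_comp_diagK (b₁ := BlockNorm.ofBlocks g (liftBlk blk ι)) (b₃ := BlockNorm.ofBlocks g (liftBlk (blk ∘ π) ι)) (liftBlk (liftBlk blk ι) J) ?_ key
    (hasMaj_injJ (liftBlk blk ι) ν))).mono ?_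
  · set A := (1 * (1 - 1 * rowConst (Fintype.card J) β cT (c35 * Fintype.card ι * a₀) cr * cr * cr))⁻¹
    set B := bgConst β cr m₀ (c35 * (Fintype.card ι * (1 + (Fintype.card J : ℝ)))) a₀
    unfold srcConst mKOf mBOf
    positivity
  · intro y y'
    refine le_of_eq ?_
    rw [bpConst2, show c35 * (Fintype.card ι : ℝ) * a₀ * (1 + (Fintype.card J : ℝ)) * θ = θ * (c35 * Fintype.card ι * a₀ * (1 + Fintype.card J)) by ring,
      show m₀ * θ = θ * m₀ by ring, show mT * θ = θ * mT by ring,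
      show bgConst β cr m₀ (c35 * ((Fintype.card ι : ℝ) * (1 + (Fintype.card J : ℝ)))) a₀ * θ =
        θ * bgConst β cr m₀ (c35 * Fintype.card ι * (1 + Fintype.card J)) a₀ by rw [mul_assoc]; ring,
      show c35 * (Fintype.card ι : ℝ) * a₀ * (1 + (Fintype.card J : ℝ)) = c35 * Fintype.card ι * a₀ * (1 + Fintype.card J) by rfl, mKOf_mul, mBOf_mul]
    ring

end Entry2

end Summit.QuantumFields.YangMills.BalabanUVNodes.N15.BackgroundLayer

end
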